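/-
Copyright (c) 2026 the pub-hodgecm-mathlib formalisation cell (harness21).  Prover seat hodgecm-mathlib-R90-C10-p04 (g2), SLAB R90-TF, section S1 «Ch. 10∕12 local»,
cell «U4-RAM :182 B_pos (inert, all residue characteristics)» (line (D-1) of R90-C10-p05 (g2); dealer R-S1-17 (B-9b)): «THE UNIT-LEVEL SKEW-BALL CHARACTER INTEGRAL ON THE
SHEAR CHART VANISHES AT POSITIVE DEPTH», for the U4Keys socket :182 (ramified `χ₁` of positive depth, Branch B) = S1 A2′, crux H413 = `stmt-HodgeConjecture-24833`.  KERNEL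
module: THEOREMS ONLY (no definition, no named fact, no `sorry`, no instance, no notation).  2026-09-05.
-/
import Summits.HodgeConjecture.HodgeConjecture.Theorems.R90S1BposSkewBallCharacterTools          -- ★ (B-4) PART 1 p863168 (this seat): §1 `integral_indicator_dite_eq_zero_of_mul_mem_iff` (orthogonality on a `u₀`-invariant set), §0 topology
import Summits.HodgeConjecture.HodgeConjecture.Theorems.K2E3BranchBSkewLineCharacterIntegralAll  -- ★ p862564 (K2E3-p32 (g2)): the SHEARED decomposition `exists_continuousAddEquiv_shear` (`Θ(t,s) = tc + s`); brings ★ p862524 `K2E3BranchBShearLineIntegrals` (`shear_add_map`, `valued_mul_shear_le`, `valued_shear_eq_one_iff_of_eq_one`, `shearLineIntegral_eq_of_valued_eq_one`)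
import HarnessLib

/-!
# R90 · S1 ∕ U4Keys leaf (U4f-χ₁-ram-one-pos), BRANCH B at EVERY inert place — (B-9b): `Φ_c := ∫_{y ∈ R⁻, |y|_w ≤ 1} χ₁((c + y)^) dμ⁻(y) = 0` AT POSITIVE DEPTH
# (shear chart `u = t·c + y`, `σc + c = 1`, ANY residue characteristic)   [Keys1984 §4–§5, §7 Thm (2); WeilBNT1967 Ch. II §5; Serre1979 Ch. V §2; Rogawski1990 §1.10, §12.2 (2)]

Cell `pub/hodgecm-mathlib` (D-0151), SLAB R90-TF, section S1 «Ch. 10∕12 local», crux H413 = `stmt-HodgeConjecture-24833` (lane `--supports … --as helper`), route of record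
`HCCMUnconditional` (no route verbs); prover seat `hodgecm-mathlib-R90-C10-p04` (g2), card (B-9b) of the B_pos line (D-1) (lead R90-C10-p05 (g2); dealer R90-C10-plan (g2)
R-S1-17 2026-09-05T00:07:33Z after R90-C10-p01 (g3)'s DYADIC CENSUS `R90/R90-C10-p01/g3/CENSUS-Bpos-dyadic.md` f5a80797891aac96: the `½`-chart statements of ★ (B-4) PART 2 hold
under `|2|_w = 1` only; the cure at `v ∣ 2` is K2E3-p32 (g2)'s SHEAR CHART).  THEOREMS ONLY (no `def`, no `instance`, no notation, no named-fact hypothesis, no `sorry`); ★-only imports (no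
`Lines` import).  NOT THE PAYER of :182.

THE POINT.  ★ `K2E3BranchBSkewLineCharacterIntegralAll.setIntegral_skewBall_dite_chi_shear_add` (p862564) computed, at DEPTH ZERO and every inert place, `Φ_c := ∫_{|y|_w ≤ 1} E(c + y)
dμ⁻ = −ε₀·μ⁻(𝔪⁻)` for the shear constant `c` (`σc + c = 1`, `|c|_w ≤ 1`, ★ FILE L1) — the `|2|`-free form of ★ (II)-b2's `Φ₁` (at `v ∤ 2`, `c = ½` and `Φ_c = Φ₁` up to the unit `½`).
THIS FILE is its POSITIVE-DEPTH twin: **`Φ_c = 0`** as soon as `χ₁` has a depth witness `u₀ ∈ 1 + 𝔪` (`|(u₀ − 1)_w| < 1`, `χ₁ u₀ ≠ 1`) — the `|2|`-free form of ★ (B-4) PART 2 (iii)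
`setIntegral_skewUnitBall_dite_one_add_eq_zero_of_posDepth` (whose base `1` and chart `a + y` need `|2|_w = 1`; p01 (g3)'s census §2 exhibits the failure at `ℚ₂(√−3)`).  PROOF
(residue-field-free, characteristic-free): the Borel set `A′ := {b ∈ R : |b_w| ≤ 1, |(b + σb)_w| = 1}` is invariant under `b ↦ u₀b` (`u₀b + σ(u₀b) = (b + σb) + (tb + σ(tb))`,
`t = u₀ − 1`, `|tb + σ(tb)|_w < 1`), so ★ PART 1 §1 gives `∫_R 𝟙_{A′} E dμR = 0` for the Haar measure `μR := (μ⁺ ⊗ μ⁻)∘Θ` pushed through the SHEARED decomposition `Θ(t, s) = tc + s`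
(★ `exists_continuousAddEquiv_shear`); in the shear chart `b + σb = t` (★ `shear_add_map`), so `A′ = Θ(S⁺₁ × B⁻_{≤1})` is a PRODUCT and Fubini (§1, the `Θ`-generic twin of ★ PART 1
§2) gives `0 = ∫_{|t| = 1} (∫_{|s| ≤ 1} E(tc + s) dμ⁻) dμ⁺ = μ⁺(S⁺₁)·Φ_c` — the fibre is the constant `Φ_c` by ★ `shearLineIntegral_eq_of_valued_eq_one` (`E(tc + s) = χ₁(t̂)E(c + t⁻¹s)`,
Branch B kills the fixed unit `t̂`, ★ `valued_shear_eq_one_iff_of_eq_one` identifies the region) — and `μ⁺(S⁺₁) > 0`.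
* §1 `integral_indicator_dite_map_equiv_eq_of_prod` — the `Θ`-generic product Fubini (any continuous additive `Θ : R⁺ × R⁻ ≃ R`).
* §2 **`setIntegral_skewUnitBall_dite_shear_add_eq_zero_of_posDepth`** — `Φ_c = 0` at positive depth, every inert place, any residue characteristic.
LETTERS = the shear kit's (★ p862524∕p862564): `hunr`, `hB` (:155∕:182's Branch-B letter verbatim), `hc`, `hcw`; the depth witness `u₀` as in ★ (B-4) PART 2.
HONEST LABEL.  HC_CM is proved only modulo the 7 printed citations (2 remaining named inputs: hLiu418 = `stmt-HodgeConjecture-24832`, h413 = `stmt-HodgeConjecture-24833`) until rung 0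
closes; count-neutral — this file does NOT pay :182 (nor :155); no printed citation is discharged; REL ≠ ★ ≠ BUILT.

## References
* [Keys1984] D. Keys, *Principal series representations of special unitary groups over local fields*, Compositio Math. 51 (1984), §4–§5, §7 Theorem (2) p. 126.
* [WeilBNT1967] A. Weil, *Basic Number Theory* (1967), Ch. I §2–§4, Ch. II §5 (Haar measure under homotheties; orthogonality of a non-trivial character of a compact group).
* [Serre1979] J.-P. Serre, *Local Fields*, GTM 67 (1979), Ch. V §2 (the trace of an unramified extension is onto: the shear constant `c`).
* [Rogawski1990] J. D. Rogawski, *Automorphic Representations of Unitary Groups in Three Variables*, Ann. of Math. Stud. 123 (1990), §1.10 p. 9, §12.2 (2) p. 173.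
-/

set_option autoImplicit false
-- the mandated namespace has the single-problem summit's repeated segment (`HodgeConjecture.HodgeConjecture`)
set_option linter.dupNamespace false

noncomputable section

open NumberField IsDedekindDomain MeasureTheory Measure Topology Set
open scoped NNReal ENNReal
open Literature.NumberTheory Literature.NumberTheory.Automorphic Literature.NumberTheory.Automorphic.UnitaryGroup

namespace Summit.HodgeConjecture.HodgeConjecture.R90.S1.BposDyadicUnitLevelShear

open Summit.HodgeConjecture.HodgeConjecture.Cruxes.H413
open Summit.HodgeConjecture.HodgeConjecture.Cruxes.H413.K2E3BranchBSkewUnitSign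
open Summit.HodgeConjecture.HodgeConjecture.Cruxes.H413.K2E3BranchBSkewLineIntegrals
open Summit.HodgeConjecture.HodgeConjecture.Cruxes.H413.K2E3BranchBShearLineIntegrals
open Summit.HodgeConjecture.HodgeConjecture.Cruxes.H413.K2E3BranchBSkewLineCharacterIntegralAll
open Summit.HodgeConjecture.HodgeConjecture.R90.S1.BposSkewBallCharacterTools

variable (L : Type) [Field L] [NumberField L] [IsCMField L] (v : HeightOneSpectrum (𝓞 ↥(maximalRealSubfield L)))
  (w : PlacesOver L v) (hw : IsCMField.complexConj L • w.1 = w.1)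

section Shear

variable [MeasurableSpace (LocalRing L v)] [BorelSpace (LocalRing L v)]

/-! ## §1 PRODUCT DECOMPOSITION through an arbitrary chart `Θ : R⁺ × R⁻ ≃ R` -/

include hw in
open scoped Classical in
/-- **`∫_R 𝟙_A E d((μ⁺ ⊗ μ⁻) ∘ Θ⁻¹) = ∫_{R⁺} 𝟙_P(t) · (∫_Y E(Θ(t, s)) dμ⁻(s)) dμ⁺(t)`** for ANY continuous additive isomorphism `Θ : R⁺ × R⁻ ≃ R` (the `Θ`-generic twin of ★ (B-4) PART 1 §2
`integral_indicator_dite_map_ringDecomp_eq_of_prod`, which is `Θ = ringDecomp⁻¹`): Borel `P ⊂ R⁺`, `Y ⊂ R⁻` inside the unit balls, Borel `A ⊂ {|b_w| = 1}` with `Θ(t, s) ∈ A ⟺ t ∈ P ∧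
s ∈ Y`; Fubini on the bounded (★ `norm_dite_apply_le_one`) integrand supported in the product of the compact unit balls. [cite: WeilBNT1967, Ch. II §5] -/
theorem integral_indicator_dite_map_equiv_eq_of_prod
    (χ₁ : (LocalRing L v)ˣ →* ℂˣ) (h₁ : Continuous fun x => ((χ₁ x : ℂˣ) : ℂ))
    (μP : Measure ↥(HeisRing.fixedPart (conjLocal L (IsCMField.complexConj L) v))) [μP.IsAddHaarMeasure]
    (μY : Measure ↥(HeisRing.skewPart (conjLocal L (IsCMField.complexConj L) v))) [μY.IsAddHaarMeasure]
    (Θ : (↥(HeisRing.fixedPart (conjLocal L (IsCMField.complexConj L) v)) × ↥(HeisRing.skewPart (conjLocal L (IsCMField.complexConj L) v))) ≃ₜ+ LocalRing L v)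
    {A : Set (LocalRing L v)} (hA : MeasurableSet A) (hA1 : ∀ b ∈ A, Valued.v (b w) = 1)
    {P : Set ↥(HeisRing.fixedPart (conjLocal L (IsCMField.complexConj L) v))}
    (hP1 : P ⊆ {a | Valued.v ((a : LocalRing L v) w) ≤ 1})
    {Y : Set ↥(HeisRing.skewPart (conjLocal L (IsCMField.complexConj L) v))}
    (hY1 : Y ⊆ {y | Valued.v ((y : LocalRing L v) w) ≤ 1})
    (hAPY : ∀ (a : ↥(HeisRing.fixedPart (conjLocal L (IsCMField.complexConj L) v))) (y : ↥(HeisRing.skewPart (conjLocal L (IsCMField.complexConj L) v))),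
      Θ (a, y) ∈ A ↔ a ∈ P ∧ y ∈ Y) :
    ∫ b, A.indicator (fun r : LocalRing L v => if h : IsUnit r then ((χ₁ h.unit : ℂˣ) : ℂ) else 0) b ∂((μP.prod μY).map Θ) =
      ∫ a, P.indicator (fun a' => ∫ y in Y,
          (fun r : LocalRing L v => if h : IsUnit r then ((χ₁ h.unit : ℂˣ) : ℂ) else 0) (Θ (a', y)) ∂μY) a ∂μP := by
  haveI : SecondCountableTopology (LocalRing L v) := secondCountableTopology_localRing (E := L) v
  have hσc := continuous_conjLocal L (IsCMField.complexConj L) v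
  haveI := HeisRing.locallyCompactSpace_fixedPart (conjLocal L (IsCMField.complexConj L) v) hσc
  haveI := HeisRing.locallyCompactSpace_skewPart (conjLocal L (IsCMField.complexConj L) v) hσc
  haveI : SecondCountableTopology ↥(HeisRing.fixedPart (conjLocal L (IsCMField.complexConj L) v)) := TopologicalSpace.Subtype.secondCountableTopology _
  haveI : SecondCountableTopology ↥(HeisRing.skewPart (conjLocal L (IsCMField.complexConj L) v)) := TopologicalSpace.Subtype.secondCountableTopology _
  set E : LocalRing L v → ℂ := fun r : LocalRing L v => if h : IsUnit r then ((χ₁ h.unit : ℂˣ) : ℂ) else 0 with hEdef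
  set meq : ↥(HeisRing.fixedPart (conjLocal L (IsCMField.complexConj L) v)) × ↥(HeisRing.skewPart (conjLocal L (IsCMField.complexConj L) v)) ≃ᵐ LocalRing L v :=
    Θ.toHomeomorph.toMeasurableEquiv with hmeq
  have hμR : (μP.prod μY).map Θ = (μP.prod μY).map meq := rfl
  have hGm : Measurable (A.indicator E) := (measurable_dite_isUnit L v w hw (fun u => ((χ₁ u : ℂˣ) : ℂ)) h₁).indicator hA
  have hGb : ∀ b, ‖A.indicator E b‖ ≤ 1 := fun b => by
    by_cases hb : b ∈ A
    · rw [Set.indicator_of_mem hb]; exact norm_dite_apply_le_one L v w hw χ₁ h₁ b (hA1 b hb)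
    · rw [Set.indicator_of_notMem hb, norm_zero]; exact zero_le_one
  set BP : Set ↥(HeisRing.fixedPart (conjLocal L (IsCMField.complexConj L) v)) := {a | Valued.v ((a : LocalRing L v) w) ≤ 1} with hBPdef
  set BY : Set ↥(HeisRing.skewPart (conjLocal L (IsCMField.complexConj L) v)) := {y | Valued.v ((y : LocalRing L v) w) ≤ 1} with hBYdef
  have hBPc : IsCompact BP :=
    (HeisRing.isClosed_fixedPart _ hσc).isClosedEmbedding_subtypeVal.isCompact_preimage (isCompact_setOf_valued_apply_le_one L v w hw)
  have hBYc : IsCompact BY :=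
    (HeisRing.isClosed_skewPart _ hσc).isClosedEmbedding_subtypeVal.isCompact_preimage (isCompact_setOf_valued_apply_le_one L v w hw)
  have hsupp : Function.support (fun p : ↥(HeisRing.fixedPart (conjLocal L (IsCMField.complexConj L) v)) ×
      ↥(HeisRing.skewPart (conjLocal L (IsCMField.complexConj L) v)) => A.indicator E (Θ p)) ⊆ BP ×ˢ BY := by
    intro p hp
    rw [Function.mem_support] at hp
    have hpA : Θ p ∈ A := by
      by_contra h; exact hp (Set.indicator_of_notMem h _)
    have hpPY := (hAPY p.1 p.2).1 hpA
    exact ⟨hP1 hpPY.1, hY1 hpPY.2⟩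
  have hint : Integrable (fun p : ↥(HeisRing.fixedPart (conjLocal L (IsCMField.complexConj L) v)) ×
      ↥(HeisRing.skewPart (conjLocal L (IsCMField.complexConj L) v)) => A.indicator E (Θ p)) (μP.prod μY) := by
    have hmeas : AEStronglyMeasurable (fun p : ↥(HeisRing.fixedPart (conjLocal L (IsCMField.complexConj L) v)) ×
        ↥(HeisRing.skewPart (conjLocal L (IsCMField.complexConj L) v)) => A.indicator E (Θ p)) (μP.prod μY) :=
      (hGm.comp Θ.continuous.measurable).aestronglyMeasurable
    have hTfin : (μP.prod μY) (BP ×ˢ BY) ≠ ⊤ := by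
      rw [Measure.prod_prod]; exact (ENNReal.mul_lt_top hBPc.measure_lt_top hBYc.measure_lt_top).ne
    exact (integrableOn_iff_integrable_of_support_subset hsupp).1
      (Measure.integrableOn_of_bounded hTfin hmeas (ae_of_all _ fun p => hGb _))
  have hinner : ∀ a : ↥(HeisRing.fixedPart (conjLocal L (IsCMField.complexConj L) v)),
      ∫ y, A.indicator E (Θ (a, y)) ∂μY = P.indicator (fun a' => ∫ y in Y, E (Θ (a', y)) ∂μY) a := by
    intro a
    by_cases ha : a ∈ P
    · rw [Set.indicator_of_mem ha]
      have hYm : MeasurableSet Y := by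
        have hsec : Y = (fun y : ↥(HeisRing.skewPart (conjLocal L (IsCMField.complexConj L) v)) => Θ (a, y)) ⁻¹' A := by
          ext y
          rw [Set.mem_preimage]
          exact ⟨fun hy => (hAPY a y).2 ⟨ha, hy⟩, fun hy => ((hAPY a y).1 hy).2⟩
        rw [hsec]
        exact hA.preimage (Θ.continuous.comp (Continuous.prodMk_right a)).measurable
      have hfun : (fun y : ↥(HeisRing.skewPart (conjLocal L (IsCMField.complexConj L) v)) => A.indicator E (Θ (a, y))) =
          Y.indicator (fun y => E (Θ (a, y))) := by
        funext y
        by_cases hy : y ∈ Y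
        · rw [Set.indicator_of_mem ((hAPY a y).2 ⟨ha, hy⟩), Set.indicator_of_mem hy]
        · rw [Set.indicator_of_notMem (fun h => hy ((hAPY a y).1 h).2), Set.indicator_of_notMem hy]
      rw [hfun, integral_indicator hYm]
    · rw [Set.indicator_of_notMem ha]
      have hfun : (fun y : ↥(HeisRing.skewPart (conjLocal L (IsCMField.complexConj L) v)) => A.indicator E (Θ (a, y))) = fun _ => 0 := by
        funext y
        rw [Set.indicator_of_notMem (fun h => ha ((hAPY a y).1 h).1)]
      rw [hfun, integral_zero]
  calc ∫ b, A.indicator E b ∂((μP.prod μY).map Θ)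
      = ∫ p, A.indicator E (meq p) ∂(μP.prod μY) := by rw [hμR]; exact integral_map_equiv meq _
    _ = ∫ p, A.indicator E (Θ (p.1, p.2)) ∂(μP.prod μY) := rfl
    _ = ∫ a, ∫ y, A.indicator E (Θ (a, y)) ∂μY ∂μP := integral_prod _ hint
    _ = ∫ a, P.indicator (fun a' => ∫ y in Y, E (Θ (a', y)) ∂μY) a ∂μP := integral_congr_ae (Filter.Eventually.of_forall hinner)

/-! ## §2 `Φ_c = 0` at positive depth -/

open scoped Classical in
include hw in
/-- **(B-9b) — `Φ_c := ∫_{y ∈ R⁻, |y|_w ≤ 1} χ₁((c + y)^) dμ⁻(y) = 0` AT POSITIVE DEPTH, EVERY INERT PLACE, ANY RESIDUE CHARACTERISTIC.**  `v` non-split (`hw`) and unramified in `L`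
(`hunr`), `χ₁` continuous in Branch B (`hB`, :155∕:182's letter verbatim) with a depth witness `u₀` (`|(u₀ − 1)_w| < 1`, `χ₁ u₀ ≠ 1`), the shear constant `c` (`σc + c = 1`, `|c|_w ≤ 1`, ★
FILE L1 at every inert place), `μ⁻` any regular additive Haar measure on `R⁻`.  The positive-depth twin of ★ `setIntegral_skewBall_dite_chi_shear_add` (depth zero: `Φ_c = −ε₀·μ⁻(𝔪⁻)`) and
the `|2|`-free form of ★ (B-4) PART 2 (iii).  PROOF: ★ PART 1 §1 on the `u₀`-invariant Borel set `A′ = {|b|_w ≤ 1, |(b + σb)_w| = 1}` for the Haar measure `(μ⁺ ⊗ μ⁻)∘Θ` of the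
SHEARED chart `Θ(t, s) = tc + s` (★ `exists_continuousAddEquiv_shear`; `μ⁺ := μ⁻ ∘ (δ·)⁻¹`, `δ` a skew unit ★ `exists_conjLocal_skew_unit`); in that chart `b + σb = t` (★ `shear_add_map`),
so `A′ = Θ(S⁺₁ × B⁻_{≤1})` and §1 gives `0 = μ⁺(S⁺₁)·Φ_c` (fibre constancy ★ `shearLineIntegral_eq_of_valued_eq_one`, region ★ `valued_shear_eq_one_iff_of_eq_one`); `μ⁺(S⁺₁) > 0`.
[cite: Keys1984, §4–§5, §7 Theorem (2) p. 126] [cite: WeilBNT1967, Ch. II §5] [cite: Serre1979, Ch. V §2] [cite: Rogawski1990, §12.2 (2) p. 173] -/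
theorem setIntegral_skewUnitBall_dite_shear_add_eq_zero_of_posDepth
    (hunr : Algebra.IsUnramifiedIn (𝓞 L) v.asIdeal)
    (χ₁ : (LocalRing L v)ˣ →* ℂˣ) (h₁ : Continuous fun x => ((χ₁ x : ℂˣ) : ℂ))
    (hB : ∀ u : (LocalRing L v)ˣ, (∀ w' : PlacesOver L v, Valued.v ((u : LocalRing L v) w') = 1) →
      χ₁ (u * Units.map (conjLocal L (IsCMField.complexConj L) v : LocalRing L v →* LocalRing L v) u) = 1)
    (u₀ : (LocalRing L v)ˣ) (hu₀ : Valued.v (((u₀ : LocalRing L v) - 1) w) < 1) (hχ : χ₁ u₀ ≠ 1)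
    {c : LocalRing L v} (hc : conjLocal L (IsCMField.complexConj L) v c + c = 1) (hcw : Valued.v (c w) ≤ 1)
    (μY : Measure ↥(HeisRing.skewPart (conjLocal L (IsCMField.complexConj L) v))) [μY.IsAddHaarMeasure] [μY.Regular] :
    ∫ y in {y : ↥(HeisRing.skewPart (conjLocal L (IsCMField.complexConj L) v)) | Valued.v ((y : LocalRing L v) w) ≤ 1},
        (fun r : LocalRing L v => if h : IsUnit r then ((χ₁ h.unit : ℂˣ) : ℂ) else 0) (c + (y : LocalRing L v)) ∂μY = 0 := by
  haveI : SecondCountableTopology (LocalRing L v) := secondCountableTopology_localRing (E := L) v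
  have hσc := continuous_conjLocal L (IsCMField.complexConj L) v
  haveI := HeisRing.locallyCompactSpace_fixedPart (conjLocal L (IsCMField.complexConj L) v) hσc
  haveI := HeisRing.locallyCompactSpace_skewPart (conjLocal L (IsCMField.complexConj L) v) hσc
  haveI : SecondCountableTopology ↥(HeisRing.fixedPart (conjLocal L (IsCMField.complexConj L) v)) := TopologicalSpace.Subtype.secondCountableTopology _
  haveI : SecondCountableTopology ↥(HeisRing.skewPart (conjLocal L (IsCMField.complexConj L) v)) := TopologicalSpace.Subtype.secondCountableTopology _
  -- names
  set E : LocalRing L v → ℂ := fun r : LocalRing L v => if h : IsUnit r then ((χ₁ h.unit : ℂˣ) : ℂ) else 0 with hEdef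
  set A : Set (LocalRing L v) := {b | Valued.v (b w) ≤ 1 ∧ Valued.v ((b + conjLocal L (IsCMField.complexConj L) v b) w) = 1} with hAdef
  set P : Set ↥(HeisRing.fixedPart (conjLocal L (IsCMField.complexConj L) v)) := {a | Valued.v ((a : LocalRing L v) w) = 1} with hPdef
  set Y : Set ↥(HeisRing.skewPart (conjLocal L (IsCMField.complexConj L) v)) := {y | Valued.v ((y : LocalRing L v) w) ≤ 1} with hYdef
  set Φ : ℂ := ∫ y in Y, E (c + (y : LocalRing L v)) ∂μY with hΦdef
  -- valuation bookkeeping (no `|2|` anywhere)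
  have hσv : ∀ b : LocalRing L v, Valued.v ((conjLocal L (IsCMField.complexConj L) v b) w) = Valued.v (b w) :=
    fun b => valued_conjLocal_apply_of_smul_eq L v w hw b
  have hA1 : ∀ b ∈ A, Valued.v (b w) = 1 := fun b hb => by
    refine le_antisymm hb.1 ?_
    have h : Valued.v ((b + conjLocal L (IsCMField.complexConj L) v b) w) ≤ Valued.v (b w) := by
      rw [Pi.add_apply]; exact (Valuation.map_add _ _ _).trans (max_le le_rfl (hσv b).le)
    exact hb.2 ▸ h
  have hunit1 : ∀ u : (LocalRing L v)ˣ, Valued.v (((u : LocalRing L v) - 1) w) < 1 → Valued.v ((u : LocalRing L v) w) = 1 := fun u hu => by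
    have h : (u : LocalRing L v) w = 1 + ((u : LocalRing L v) - 1) w := by rw [Pi.sub_apply, Pi.one_apply, add_sub_cancel]
    rw [h]; exact Valuation.map_one_add_of_lt _ hu
  have hstep : ∀ (u : (LocalRing L v)ˣ) (b : LocalRing L v), Valued.v (((u : LocalRing L v) - 1) w) < 1 → b ∈ A → (u : LocalRing L v) * b ∈ A := fun u b hu hb => by
    have hbv : Valued.v (b w) = 1 := hA1 b hb
    refine ⟨?_, ?_⟩
    · show Valued.v (((u : LocalRing L v) * b) w) ≤ 1
      rw [Pi.mul_apply, map_mul, hunit1 u hu, one_mul]; exact hb.1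
    · show Valued.v (((u : LocalRing L v) * b + conjLocal L (IsCMField.complexConj L) v ((u : LocalRing L v) * b)) w) = 1
      have hsplit : (u : LocalRing L v) * b + conjLocal L (IsCMField.complexConj L) v ((u : LocalRing L v) * b) =
          (b + conjLocal L (IsCMField.complexConj L) v b) +
            (((u : LocalRing L v) - 1) * b + conjLocal L (IsCMField.complexConj L) v (((u : LocalRing L v) - 1) * b)) := by
        rw [show (u : LocalRing L v) * b = b + ((u : LocalRing L v) - 1) * b by ring, map_add]; ring
      have hsmall : Valued.v ((((u : LocalRing L v) - 1) * b + conjLocal L (IsCMField.complexConj L) v (((u : LocalRing L v) - 1) * b)) w) < 1 := by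
        rw [Pi.add_apply]
        refine lt_of_le_of_lt (Valuation.map_add _ _ _) (max_lt ?_ ?_)
        · rw [Pi.mul_apply, map_mul, hbv, mul_one]; exact hu
        · rw [hσv, Pi.mul_apply, map_mul, hbv, mul_one]; exact hu
      rw [hsplit, Pi.add_apply, Valuation.map_add_eq_of_lt_left _ (by rw [hb.2]; exact hsmall), hb.2]
  have hu₀inv : Valued.v ((((u₀⁻¹ : (LocalRing L v)ˣ) : LocalRing L v) - 1) w) < 1 := by
    have h : (((u₀⁻¹ : (LocalRing L v)ˣ) : LocalRing L v) - 1) w = -((((u₀⁻¹ : (LocalRing L v)ˣ) : LocalRing L v) w) * (((u₀ : LocalRing L v) - 1) w)) := by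
      have h1 := units_apply_mul_inv_apply L v u₀ w
      simp only [Pi.sub_apply, Pi.one_apply]
      linear_combination h1
    rw [h, Valuation.map_neg, map_mul, valued_units_inv_apply_eq_one L v (hunit1 _ hu₀), one_mul]; exact hu₀
  -- `A` is Borel and `u₀`-invariant
  have hA : MeasurableSet A := by
    have h : A = {b : LocalRing L v | Valued.v (b w) ≤ 1} ∩
        (fun b : LocalRing L v => (b + conjLocal L (IsCMField.complexConj L) v b) w) ⁻¹' {z : w.1.adicCompletion L | Valued.v z = 1} := rfl
    rw [h]
    exact (isClosed_setOf_valued_apply_le_one L v w).measurableSet.inter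
      (((isOpen_setOf_valued_eq_one L v w).preimage ((continuous_apply w).comp (continuous_id.add hσc))).measurableSet)
  have hAu : ∀ b : LocalRing L v, (u₀ : LocalRing L v) * b ∈ A ↔ b ∈ A := fun b => by
    refine ⟨fun h => ?_, fun h => hstep u₀ b hu₀ h⟩
    have h' := hstep u₀⁻¹ ((u₀ : LocalRing L v) * b) hu₀inv h
    rwa [← mul_assoc, Units.inv_mul, one_mul] at h'
  have hu₀' : ∀ w' : PlacesOver L v, Valued.v ((u₀ : LocalRing L v) w') = 1 := forall_placesOver_of_apply L v w hw (hunit1 _ hu₀)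
  -- the SHEARED chart `Θ(t, s) = tc + s` and the product structure of `A` in it
  obtain ⟨Θ, hΘ⟩ := exists_continuousAddEquiv_shear L v hc
  have hP1 : P ⊆ {a | Valued.v ((a : LocalRing L v) w) ≤ 1} := fun a ha => le_of_eq ha
  have hY1 : Y ⊆ {y | Valued.v ((y : LocalRing L v) w) ≤ 1} := fun y hy => hy
  have hAPY : ∀ (a : ↥(HeisRing.fixedPart (conjLocal L (IsCMField.complexConj L) v))) (y : ↥(HeisRing.skewPart (conjLocal L (IsCMField.complexConj L) v))),
      Θ (a, y) ∈ A ↔ a ∈ P ∧ y ∈ Y := fun a y => by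
    have ha : conjLocal L (IsCMField.complexConj L) v (a : LocalRing L v) = a := (HeisRing.mem_fixedPart_iff _ _).1 a.2
    have hy : conjLocal L (IsCMField.complexConj L) v (y : LocalRing L v) = -(y : LocalRing L v) := (HeisRing.mem_skewPart_iff _ _).1 y.2
    have htr := shear_add_map L v ha hy hc
    rw [hΘ]
    show (Valued.v (((a : LocalRing L v) * c + (y : LocalRing L v)) w) ≤ 1 ∧
        Valued.v ((((a : LocalRing L v) * c + (y : LocalRing L v)) + conjLocal L (IsCMField.complexConj L) v ((a : LocalRing L v) * c + (y : LocalRing L v))) w) = 1) ↔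
      (Valued.v ((a : LocalRing L v) w) = 1 ∧ Valued.v ((y : LocalRing L v) w) ≤ 1)
    rw [htr]
    constructor
    · rintro ⟨hb1, hat⟩
      refine ⟨hat, ?_⟩
      have hsub : (y : LocalRing L v) = ((a : LocalRing L v) * c + (y : LocalRing L v)) - (a : LocalRing L v) * c := by ring
      rw [hsub, Pi.sub_apply]
      exact (Valuation.map_sub _ _ _).trans (max_le hb1 ((valued_mul_shear_le L v w hcw).trans hat.le))
    · rintro ⟨hat, hy1⟩
      refine ⟨?_, hat⟩
      rw [Pi.add_apply]
      exact (Valuation.map_add _ _ _).trans (max_le ((valued_mul_shear_le L v w hcw).trans hat.le) hy1)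
  -- `μ⁺` and the Haar measure `(μ⁺ ⊗ μ⁻) ∘ Θ⁻¹` on `R`
  obtain ⟨δ, hδ⟩ := exists_conjLocal_skew_unit L v
  set eP := HeisRing.mulSkewUnit (conjLocal L (IsCMField.complexConj L) v) δ hδ with hePdef
  set μP : Measure ↥(HeisRing.fixedPart (conjLocal L (IsCMField.complexConj L) v)) := μY.map eP.symm with hμPdef
  haveI hμP : μP.IsAddHaarMeasure := ContinuousAddEquiv.isAddHaarMeasure_map μY eP.symm
  haveI : (μP.prod μY).IsAddHaarMeasure := inferInstance
  haveI : ((μP.prod μY).map Θ).IsAddHaarMeasure := ContinuousAddEquiv.isAddHaarMeasure_map (μP.prod μY) Θ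
  -- ★ PART 1 §1 orthogonality, §1 product Fubini, ★ shear fibre constancy
  have horth := integral_indicator_dite_eq_zero_of_mul_mem_iff L v w hw ((μP.prod μY).map Θ) χ₁ h₁ u₀ hu₀' hχ hA hAu
  rw [integral_indicator_dite_map_equiv_eq_of_prod L v w hw χ₁ h₁ μP μY Θ hA hA1 hP1 hY1 hAPY] at horth
  have hfib : ∀ a : ↥(HeisRing.fixedPart (conjLocal L (IsCMField.complexConj L) v)),
      P.indicator (fun a' => ∫ y in Y, E (Θ (a', y)) ∂μY) a = P.indicator (fun _ => Φ) a := fun a => by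
    by_cases ha : a ∈ P
    · rw [Set.indicator_of_mem ha, Set.indicator_of_mem ha]
      have hafix : conjLocal L (IsCMField.complexConj L) v (a : LocalRing L v) = a := (HeisRing.mem_fixedPart_iff _ _).1 a.2
      have hav : Valued.v ((a : LocalRing L v) w) = 1 := ha
      have hfun : (fun y : ↥(HeisRing.skewPart (conjLocal L (IsCMField.complexConj L) v)) => E (Θ (a, y))) =
          fun y : ↥(HeisRing.skewPart (conjLocal L (IsCMField.complexConj L) v)) => E ((a : LocalRing L v) * c + (y : LocalRing L v)) := by
        funext y; rw [hΘ]
      have hreg : Y = {y : ↥(HeisRing.skewPart (conjLocal L (IsCMField.complexConj L) v)) | Valued.v (((a : LocalRing L v) * c + (y : LocalRing L v)) w) = 1} := by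
        ext y
        exact (valued_shear_eq_one_iff_of_eq_one L v w hw hafix ((HeisRing.mem_skewPart_iff _ _).1 y.2) hc hcw hav).symm
      rw [hfun, hreg]
      exact shearLineIntegral_eq_of_valued_eq_one L v w hw μY hunr χ₁ hB hc hcw hafix hav
    · rw [Set.indicator_of_notMem ha, Set.indicator_of_notMem ha]
  have hPm : MeasurableSet P := measurable_subtype_coe (measurableSet_setOf_valued_apply_eq_one L v w)
  rw [integral_congr_ae (Filter.Eventually.of_forall hfib), integral_indicator_const Φ hPm, Complex.real_smul] at horth
  -- `0 < μ⁺(P) < ∞`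
  have hPo : IsOpen P := by
    have h : P = (fun a : ↥(HeisRing.fixedPart (conjLocal L (IsCMField.complexConj L) v)) => (a : LocalRing L v) w) ⁻¹' {z : w.1.adicCompletion L | Valued.v z = 1} := rfl
    rw [h]
    exact (isOpen_setOf_valued_eq_one L v w).preimage ((continuous_apply w).comp continuous_subtype_val)
  have hPne : P.Nonempty := ⟨⟨1, (HeisRing.mem_fixedPart_iff _ _).2 (map_one _)⟩, by
    show Valued.v ((1 : LocalRing L v) w) = 1
    rw [Pi.one_apply, map_one]⟩
  have hPfin : μP P ≠ ⊤ := by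
    have hBPc : IsCompact {a : ↥(HeisRing.fixedPart (conjLocal L (IsCMField.complexConj L) v)) | Valued.v ((a : LocalRing L v) w) ≤ 1} :=
      (HeisRing.isClosed_fixedPart _ hσc).isClosedEmbedding_subtypeVal.isCompact_preimage (isCompact_setOf_valued_apply_le_one L v w hw)
    exact ((measure_mono hP1).trans_lt hBPc.measure_lt_top).ne
  have hPpos : (μP.real P : ℂ) ≠ 0 := by
    rw [Ne, Complex.ofReal_eq_zero, measureReal_def, ENNReal.toReal_eq_zero_iff, not_or]
    exact ⟨(hPo.measure_pos μP hPne).ne', hPfin⟩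
  exact (mul_eq_zero.1 horth).resolve_left hPpos

end Shear

end Summit.HodgeConjecture.HodgeConjecture.R90.S1.BposDyadicUnitLevelShear

end
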